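import Summits.CriticalPhenomena.PercolationContinuityZ3.Theorems.PercNearOneGluingNoHeavyLowerTailSunflowerBipartiteCover

/-!
# `NoHeavyLowerTail` (crux stmt-CriticalPhenomena-4575), abstract sunflower cubic: BAL-bip COROLLARIES IN COLOURING FORM

Support file (seat `prim-ineq-prove-1` gen 46; `--supports stmt-CriticalPhenomena-4575`).  Continues `…SunflowerBipartiteCover`.
* `isBip_of_coloring_on`: a proper `2`-colouring of a graph whose edges lie inside the vertex block `V` gives `IsBip Γ L R` with
  `L ∪ R = V` (the two colour classes inside `V`);
* **`gsafe_edgeCore_of_coloring`**: every `2`-colourable graph core of positive probability is GRADEDLY SAFE on its vertex block;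
* **`safe_edgeCore_sup_of_coloring`**: `Safe p (edgeCore (Γ ⊔ Γ'))` for a `2`-colourable `Γ` inside `V` and ANY A-safe `Γ'` inside `Vᶜ`
  (both of positive core probability) — the bipartite ⊔-closure of A-safety (memo FINDING-PAR-prove1-g46 §0, Corollaries).
-/

noncomputable section

namespace Summit.CriticalPhenomena.PercolationContinuityZ3.Theorems.SunflowerPartition

namespace BipCover

open Finset SafeCalc
open MeasureTheory Literature.Probability.LatticeModels Literature.Probability.Percolation

variable {ι : Type*} [Fintype ι] [DecidableEq ι] (p : ι → unitInterval)

omit [Fintype ι] [DecidableEq ι] in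
/-- The two colour classes of a proper `2`-colouring, inside a block `V` containing all edges, form an `IsBip` structure. [this work] -/
theorem isBip_of_coloring_on (Γ : SimpleGraph ι) (V : Finset ι) (hV : ∀ u v, Γ.Adj u v → u ∈ V ∧ v ∈ V)
    (C : Γ.Coloring (Fin 2)) :
    IsBip Γ (V.filter fun v => C v = 0) (V.filter fun v => C v ≠ 0) := by
  refine ⟨disjoint_filter_filter_not V V (fun v => C v = 0), fun u v huv => ?_⟩
  have hne : C u ≠ C v := C.valid huv
  obtain ⟨hu, hv⟩ := hV u v huv
  by_cases h0 : C u = 0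
  · refine Or.inl ⟨mem_filter.mpr ⟨hu, h0⟩, mem_filter.mpr ⟨hv, fun h => hne (h0.trans h.symm)⟩⟩
  · refine Or.inr ⟨mem_filter.mpr ⟨hu, h0⟩, mem_filter.mpr ⟨hv, ?_⟩⟩
    -- in `Fin 2`, two values different from each other and `C u ≠ 0` force `C v = 0`
    have h2 : ∀ a : Fin 2, a ≠ 0 → a = 1 := by decide
    by_contra hv0
    exact hne ((h2 _ h0).trans (h2 _ hv0).symm)

omit [Fintype ι] in
/-- The union of the two colour classes inside `V` is `V`. [this work] -/
theorem colorClasses_union (Γ : SimpleGraph ι) (V : Finset ι) (C : Γ.Coloring (Fin 2)) :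
    (V.filter fun v => C v = 0) ∪ (V.filter fun v => C v ≠ 0) = V :=
  Finset.filter_union_filter_not_eq _ V

/-- **Graded safety of every `2`-colourable graph core** (on any block containing its edges). [this work] -/
theorem gsafe_edgeCore_of_coloring (Γ : SimpleGraph ι) [DecidableRel Γ.Adj] (V : Finset ι)
    (hV : ∀ u v, Γ.Adj u v → u ∈ V ∧ v ∈ V) (C : Γ.Coloring (Fin 2))
    (hpos : 0 < (prodBernoulli p).real (edgeCore Γ)) : GSafe p V (edgeCore Γ) := by
  have h := gsafe_edgeCore_bipartite p (isBip_of_coloring_on Γ V hV C) hpos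
  rwa [colorClasses_union Γ V C] at h

/-- **Bipartite ⊔-closure of A-safety**: a `2`-colourable graph inside `V` joined with any A-safe graph inside `Vᶜ`. [this work] -/
theorem safe_edgeCore_sup_of_coloring (Γ Γ' : SimpleGraph ι) [DecidableRel Γ.Adj] (V : Finset ι)
    (hV : ∀ u v, Γ.Adj u v → u ∈ V ∧ v ∈ V) (C : Γ.Coloring (Fin 2)) (hpos : 0 < (prodBernoulli p).real (edgeCore Γ))
    (hV' : ∀ u v, Γ'.Adj u v → u ∉ V ∧ v ∉ V) (hpos' : 0 < (prodBernoulli p).real (edgeCore Γ'))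
    (hsafe : Safe p (edgeCore Γ')) : Safe p (edgeCore (Γ ⊔ Γ')) := by
  have h := safe_edgeCore_bipartite_sup p (isBip_of_coloring_on Γ V hV C) hpos Γ' (fun u v huv => ?_) hpos' hsafe
  · exact h
  · rw [colorClasses_union Γ V C]
    exact hV' u v huv

end BipCover

end Summit.CriticalPhenomena.PercolationContinuityZ3.Theorems.SunflowerPartition
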